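import Summits.ResolutionOfSingularities.ResolutionOfSingularities.Theorems.WeightedInvariantIota3TauDescentAdmStep
import Summits.ResolutionOfSingularities.ResolutionOfSingularities.Theorems.AQSHeightTwoLexMaxGerm
import HarnessLib

/-!
# (desc-τ), CASE B: THE ABRAMOVICH–QUEK–SCHOBER DATUM AT `T_{P₀}` WITH THE TIE'S WEIGHTS (existence, ascent, uniqueness)
# (door `HypersurfaceCentreConstruction`, stmt-ResolutionOfSingularities-19897; gap (1) (desc-τ) of the P3 rung `stub_keyRungGrHomLE_three`)

Topic: `Summits/ResolutionOfSingularities/ResolutionOfSingularities/Theorems`. Helper for the door item `HypersurfaceCentreConstruction`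
(stmt-ResolutionOfSingularities-19897, route `WeightedInvariant`), line `local-engine`, def-free.  …Iota3TauDescentDoorAdm reduced (desc-τ) for bases
essentially of finite type over a field to (ADAPT-adm); THIS FILE supplies the datum downstairs that the proof of (ADAPT-adm) (…Iota3TauDescentAdm)
corrects into an rsp-adapted one:

* `Iota3.isLexMaxWeightedCentreGerm_atPrime_map'` — ascent of an ARBITRARY lex-maximal datum of `T_P` (not necessarily presented on `T`) along the
  localised homomorphism `T_P → T'_{PT'}` (copy of …TauEssSmoothAscent for general pairs).
* `Iota3.exists_aqs_datum_atPrime` — at `O = T_{P₀}` (`T` essentially of finite type over a field, `(T', φ g)` a tie with presentation of weights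
  `(q, r)`, order `ν`) the Abramovich–Quek–Schober datum `(y₁, x₁; r, q; rν)` of `(g/1)` EXISTS with the tie's weights (existence at `O`, ascent,
  uniqueness at `T'_{P₀T'}`; `(g/1)` is not a power of a regular parameter because the steep datum upstairs bounds every admissible slope).
[OURS · L1 W4.3 · (desc-τ) case B, AQS datum at the curve]  Replaces the role of NO printed item; NOT a statement of the manuscript under review
[claim: Hironaka2017, status: under-review]; candidates stay candidates; AI work, weaker than expert review.  No definition; no axiom.

## References

* D. Abramovich, M. H. Quek, B. Schober, arXiv:2507.01232 (2025), Thm 1.3, Thm 3.5. [AbramovichQuekSchober2025]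
* H. Matsumura, *Commutative Ring Theory* (1986), Thm. 7.5, Thm. 11.2, Thm. 14.2. [Matsumura1987]
-/

noncomputable section

set_option linter.dupNamespace false -- mandated namespace `Summit.<Summit>.<Problem>` of this single-conjunct summit

open IsLocalRing Literature.AlgebraicGeometry.Resolution
open Summit.ResolutionOfSingularities.ResolutionOfSingularities.Theorems
open Summit.ResolutionOfSingularities.ResolutionOfSingularities.Theorems.ContactCylinder

namespace Summit.ResolutionOfSingularities.ResolutionOfSingularities.Cruxes.HypersurfaceCentreConstruction.LocalEngine

namespace Iota3

/-! ## §1 Ascent of an arbitrary datum along the localised homomorphism -/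

section Ascent

variable (S S' : Type) [CommRing S] [CommRing S'] [IsRegularLocalRing S] [IsRegularLocalRing S'] [Algebra S S']
  [IsLocalHom (algebraMap S S')] [Algebra.FormallySmooth S S'] [Algebra.EssFiniteType S S']

/-- **An arbitrary lex-maximal datum of `S_P` ascends to `S'_{PS'}`** (`P = (x, y)`, `(φ x, φ y)` prime, `dim S_P = 2`); the datum is pushed along
`Localization.localRingHom`. [cite: AbramovichQuekSchober2025, Thm 3.5] -/
theorem isLexMaxWeightedCentreGerm_atPrime_map' (x y f : S) [(Ideal.span ({x, y} : Set S)).IsPrime]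
    [(Ideal.span ({algebraMap S S' x, algebraMap S S' y} : Set S')).IsPrime]
    (hdimP : ringKrullDim (Localization.AtPrime (Ideal.span ({x, y} : Set S))) = (2 : ℕ))
    {u : Fin 2 → Localization.AtPrime (Ideal.span ({x, y} : Set S))} {w : Fin 2 → ℕ} {ℓ : ℕ}
    (hlex : IsLexMaxWeightedCentreGerm (Localization.AtPrime (Ideal.span ({x, y} : Set S)))
      (Ideal.span {algebraMap S (Localization.AtPrime (Ideal.span ({x, y} : Set S))) f}) u w ℓ) :
    IsLexMaxWeightedCentreGerm (Localization.AtPrime (Ideal.span ({algebraMap S S' x, algebraMap S S' y} : Set S')))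
      (Ideal.span {algebraMap S' (Localization.AtPrime (Ideal.span ({algebraMap S S' x, algebraMap S S' y} : Set S')))
        (algebraMap S S' f)})
      (fun i => Localization.localRingHom (Ideal.span ({x, y} : Set S)) (Ideal.span ({algebraMap S S' x, algebraMap S S' y} : Set S'))
        (algebraMap S S') (comap_span_pair_map S S' x y).symm (u i))
      w ℓ := by
  classical
  set P : Ideal S := Ideal.span ({x, y} : Set S) with hPdef
  set P' : Ideal S' := Ideal.span ({algebraMap S S' x, algebraMap S S' y} : Set S') with hP'def
  have hcomap : P'.comap (algebraMap S S') = P := comap_span_pair_map S S' x y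
  have hmapP : P.map (algebraMap S S') = P' := by rw [hPdef, map_span_pair]
  haveI : IsRegularLocalRing (Localization.AtPrime P) := isRegularLocalRing_localization_atPrime S P
  haveI : IsRegularLocalRing (Localization.AtPrime P') := isRegularLocalRing_localization_atPrime S' P'
  letI : Algebra (Localization.AtPrime P) (Localization.AtPrime P') :=
    (Localization.localRingHom P P' (algebraMap S S') hcomap.symm).toAlgebra
  haveI : IsScalarTower S (Localization.AtPrime P) (Localization.AtPrime P') := IsScalarTower.of_algebraMap_eq fun s => by
    change _ = Localization.localRingHom P P' (algebraMap S S') hcomap.symm (algebraMap S (Localization.AtPrime P) s)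
    rw [Localization.localRingHom_to_map, IsScalarTower.algebraMap_apply S S' (Localization.AtPrime P')]
  haveI : IsLocalHom (algebraMap (Localization.AtPrime P) (Localization.AtPrime P')) :=
    Localization.isLocalHom_localRingHom P P' (algebraMap S S') hcomap.symm
  haveI : Algebra.FormallySmooth S (Localization.AtPrime P') := Algebra.FormallySmooth.comp S S' (Localization.AtPrime P')
  haveI : Algebra.EssFiniteType S (Localization.AtPrime P') := Algebra.EssFiniteType.comp S S' (Localization.AtPrime P')
  haveI : Algebra.FormallySmooth (Localization.AtPrime P) (Localization.AtPrime P') :=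
    Algebra.FormallySmooth.localization_base P.primeCompl
  haveI : Algebra.EssFiniteType (Localization.AtPrime P) (Localization.AtPrime P') :=
    Algebra.EssFiniteType.of_comp S (Localization.AtPrime P) (Localization.AtPrime P')
  haveI : Module.Flat (Localization.AtPrime P) (Localization.AtPrime P') :=
    IotaOrderEssSmooth.flat_of_formallySmooth_of_essFiniteType (Localization.AtPrime P) (Localization.AtPrime P')
  haveI : Module.FaithfullyFlat (Localization.AtPrime P) (Localization.AtPrime P') := Module.FaithfullyFlat.of_flat_of_isLocalHom
  have h𝔪 : (maximalIdeal (Localization.AtPrime P)).map (algebraMap (Localization.AtPrime P) (Localization.AtPrime P')) =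
      maximalIdeal (Localization.AtPrime P') := by
    have h1 : maximalIdeal (Localization.AtPrime P) = P.map (algebraMap S (Localization.AtPrime P)) :=
      (Localization.AtPrime.map_eq_maximalIdeal).symm
    have h2 : maximalIdeal (Localization.AtPrime P') = P'.map (algebraMap S' (Localization.AtPrime P')) :=
      (Localization.AtPrime.map_eq_maximalIdeal).symm
    rw [h1, h2, Ideal.map_map, ← IsScalarTower.algebraMap_eq S (Localization.AtPrime P) (Localization.AtPrime P'),
      IsScalarTower.algebraMap_eq S S' (Localization.AtPrime P'), ← Ideal.map_map, hmapP]
  have hdimP' : ringKrullDim (Localization.AtPrime P') = (2 : ℕ) := by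
    obtain ⟨a, b, c, ha, hb, hc, hab⟩ := EssSmoothLE2.exists_dims (Localization.AtPrime P) (Localization.AtPrime P')
    have ha2 : a = 2 := by
      have h : ((a : ℕ) : WithBot ℕ∞) = (2 : ℕ) := ha.symm.trans hdimP
      exact_mod_cast h
    have hcongr : ∀ (I J : Ideal (Localization.AtPrime P')), I = J →
        ringKrullDim (Localization.AtPrime P' ⧸ I) = ringKrullDim (Localization.AtPrime P' ⧸ J) := by
      rintro I J rfl; rfl
    have hc0 : c = 0 := by
      have hF : IsField (Localization.AtPrime P' ⧸ maximalIdeal (Localization.AtPrime P')) :=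
        (Ideal.Quotient.maximal_ideal_iff_isField_quotient (maximalIdeal (Localization.AtPrime P'))).mp inferInstance
      have h := (hcongr _ _ h𝔪).symm.trans hc
      rw [ringKrullDim_eq_zero_of_isField hF] at h
      have h' : ((0 : ℕ) : WithBot ℕ∞) = c := by exact_mod_cast h
      exact_mod_cast h'.symm
    rw [hb, hab, ha2, hc0]
  letI := (IsLocalRing.ResidueField.map (algebraMap (Localization.AtPrime P) (Localization.AtPrime P'))).toAlgebra
  haveI : Algebra.FormallySmooth (ResidueField (Localization.AtPrime P)) (ResidueField (Localization.AtPrime P')) :=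
    AQSBaseChange.formallySmooth_residueField_of_map_maximalIdeal_eq (Localization.AtPrime P) (Localization.AtPrime P') h𝔪
  set p := ringExpChar (ResidueField (Localization.AtPrime P)) with hp
  haveI : ExpChar (ResidueField (Localization.AtPrime P')) p :=
    expChar_of_injective_ringHom (algebraMap (ResidueField (Localization.AtPrime P)) (ResidueField (Localization.AtPrime P'))).injective p
  have hcl : ∀ z : ResidueField (Localization.AtPrime P'),
      z ^ p ∈ (IsLocalRing.ResidueField.map (algebraMap (Localization.AtPrime P) (Localization.AtPrime P'))).range →
      z ∈ (IsLocalRing.ResidueField.map (algebraMap (Localization.AtPrime P) (Localization.AtPrime P'))).range := fun z hz =>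
    AQSBaseChange.mem_range_algebraMap_of_pow_mem (E := ResidueField (Localization.AtPrime P)) (L := ResidueField (Localization.AtPrime P')) p hz
  have key := AQSBaseChange.isLexMaxWeightedCentreGerm_map hdimP hdimP' h𝔪 p hcl hlex
  have hφ : algebraMap (Localization.AtPrime P) (Localization.AtPrime P') (algebraMap S (Localization.AtPrime P) f) =
      algebraMap S' (Localization.AtPrime P') (algebraMap S S' f) := by
    rw [← IsScalarTower.algebraMap_apply S (Localization.AtPrime P) (Localization.AtPrime P'),
      IsScalarTower.algebraMap_apply S S' (Localization.AtPrime P')]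
  rw [hφ] at key
  exact key

end Ascent

/-! ## §2 The Abramovich–Quek–Schober datum at `T_{P₀}` with the tie's weights -/

section Datum

variable (T T' : Type) [CommRing T] [CommRing T'] [IsRegularLocalRing T] [IsRegularLocalRing T'] [Algebra T T']
  [IsLocalHom (algebraMap T T')] [Algebra.FormallySmooth T T'] [Algebra.EssFiniteType T T']

/-- **THE AQS DATUM OF `(g/1) ⊆ T_{P₀}` EXISTS AND HAS THE TIE'S WEIGHTS** (`T` essentially of finite type over a field). [OURS]
[cite: AbramovichQuekSchober2025, Thm 1.3 (1), Thm 3.5] -/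
theorem exists_aqs_datum_atPrime (k₀ : Type) [Field k₀] [Algebra k₀ T] [Algebra.EssFiniteType k₀ T]
    (hdimT : ringKrullDim T = (3 : ℕ)) {g : T} (ht' : IsTiePosition T' (algebraMap T T' g))
    {x' y' z' : T'} {q r : ℕ} {lam' : T'} (h' : IsTiePresentation T' (algebraMap T T' g) x' y' z' q r lam')
    {ν : ℕ} (hfν : algebraMap T T' g ∈ maximalIdeal T' ^ ν) (hfν1 : algebraMap T T' g ∉ maximalIdeal T' ^ (ν + 1))
    {x y : T} [hP : (Ideal.span ({x, y} : Set T)).IsPrime] (hP₀ : topStratumPrime iotaOrdEps T g = Ideal.span {x, y}) :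
    0 < q ∧ 1 ≤ ν ∧ ringKrullDim (Localization.AtPrime (Ideal.span ({x, y} : Set T))) = (2 : ℕ) ∧
      ∃ y₁ x₁ : Localization.AtPrime (Ideal.span ({x, y} : Set T)),
      Ideal.span {x₁, y₁} = maximalIdeal (Localization.AtPrime (Ideal.span ({x, y} : Set T))) ∧
      algebraMap T (Localization.AtPrime (Ideal.span ({x, y} : Set T))) g ∈ weightedMonomialIdeal ![y₁, x₁] ![r, q] (r * ν) := by
  classical
  -- dimensions and `𝔪_T T' = 𝔪'`
  obtain ⟨hdimT'n, -⟩ := ringKrullDim_eq_of_isTiePosition_map T T' ht'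
  have hdim3 : ringKrullDim T = 3 := by rw [hdimT]; rfl
  have hdim3' : ringKrullDim T' = 3 := by rw [hdimT'n]; rfl
  haveI : Module.Flat T T' := IotaOrderEssSmooth.flat_of_formallySmooth_of_essFiniteType T T'
  obtain ⟨-, -, ν', hP'inst, hν'1, hν'2, hlex0, -⟩ := id h'
  haveI := hP'inst
  obtain rfl : ν = ν' := eq_of_mem_pow_of_not_mem_pow hfν hfν1 hν'1 hν'2
  have hlex' : IsLexMaxWeightedCentreGerm (Localization.AtPrime (Ideal.span ({x', y'} : Set T')))
      (Ideal.span {algebraMap T' _ (algebraMap T T' g)}) ![algebraMap T' _ y', algebraMap T' _ x'] ![r, q] (r * ν) := hlex0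
  have hq : 0 < q := hlex'.2.1 1
  have hν1 : 1 ≤ ν := by
    have h := hlex'.2.2.2.2.1
    rcases Nat.eq_zero_or_pos ν with h0 | h0
    · rw [h0, mul_zero] at h; exact absurd h (lt_irrefl 0)
    · exact h0
  -- `g`: order, `ε`, the stratum and its extension
  obtain ⟨hgν, hgν1⟩ := mem_pow_and_not_mem_of_map T T' hfν hfν1
  have hg0 : g ≠ 0 := fun h0 => ht'.ne_zero (by rw [h0, map_zero])
  have hg𝔪 : g ∈ maximalIdeal T := by
    refine (IsLocalRing.mem_maximalIdeal g).mpr (mem_nonunits_iff.mpr fun hu => ?_)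
    exact (IsLocalRing.mem_maximalIdeal _).mp ht'.mem_maximalIdeal (hu.map (algebraMap T T'))
  have hnm : ¬ IsMonomialType g := not_isMonomialType_of_isTiePosition_map T T' ht'
  have hν : iotaOrd T g = ν := (iotaOrd_eq_natCast_iff T g ν).mpr ⟨hgν, hgν1⟩
  obtain ⟨_, -, hε', -, -⟩ := id ht'
  have hε : iotaEps T g = 0 := by rw [← iotaEps_essSmooth_eq T T' g]; exact hε'
  obtain ⟨hP₀p, hreg, -, hE, -, hmemν⟩ := topStratumPrime_iotaOrdEps_spec (le_of_eq hdim3) hg0 hg𝔪 hν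
  obtain ⟨hP₀'p, -, -, hP₀map⟩ := topStratumPrime_iotaOrdEps_map_eq T T' g hreg hE
  have hPmap : (topStratumPrime iotaOrdEps T g).map (algebraMap T T') =
      Ideal.span {algebraMap T T' x, algebraMap T T' y} := by rw [hP₀, map_span_pair]
  haveI hPxy' : (Ideal.span ({algebraMap T T' x, algebraMap T T' y} : Set T')).IsPrime := hPmap ▸ hP₀'p
  have hP₀'' : topStratumPrime iotaOrdEps T' (algebraMap T T' g) = Ideal.span {algebraMap T T' x, algebraMap T T' y} :=
    hP₀map.trans hPmap
  have hregP : IsRegularLocalRing (T ⧸ Ideal.span ({x, y} : Set T)) := by rw [← hP₀]; exact hreg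
  have hPle : Ideal.span ({x, y} : Set T) ≤ maximalIdeal T := IsLocalRing.le_maximalIdeal (Ideal.IsPrime.ne_top hP)
  -- `dim T_{(x,y)} = 2`
  have hsf : (maximalIdeal T).spanFinrank = 3 := spanFinrank_eq_three_of_ringKrullDim hdim3
  have hdimP : ringKrullDim (Localization.AtPrime (Ideal.span ({x, y} : Set T))) = (2 : ℕ) := by
    refine le_antisymm (ringKrullDim_atPrime_span_pair_le_two x y) ?_
    have hmem : (⟨Ideal.span {x, y}, hP⟩ : PrimeSpectrum T) ∈ topStratum iotaOrd T g := by
      rw [← topStratum_iotaOrdEps_eq_topStratum_iotaOrd_of_iotaEps_eq_zero hg𝔪 hε, hE, Set.mem_setOf_eq, hP₀]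
    have hht := two_le_height_of_mem_topStratum_iotaOrd hg0 hg𝔪 hnm hmem
    dsimp only at hht
    rw [IsLocalization.AtPrime.ringKrullDim_eq_height (Ideal.span ({x, y} : Set T)) (Localization.AtPrime (Ideal.span ({x, y} : Set T)))]
    have h2 : ((2 : ℕ) : WithBot ℕ∞) = (((2 : ℕ) : ℕ∞) : WithBot ℕ∞) := rfl
    rw [h2]
    exact WithBot.coe_le_coe.mpr (by exact_mod_cast hht)
  -- the presentation's datum, transported to the prime `(φ x, φ y)`
  have hPeq : Ideal.span ({x', y'} : Set T') = Ideal.span {algebraMap T T' x, algebraMap T T' y} := h'.2.1.symm.trans hP₀''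
  have hPQ : (Ideal.span ({x', y'} : Set T')).map ((RingEquiv.refl T' : T' ≃+* T') : T' →+* T') =
      Ideal.span {algebraMap T T' x, algebraMap T T' y} := by
    rw [map_span_pair]; exact hPeq
  have he : ∀ t : T', (locRingEquiv (RingEquiv.refl T') (Ideal.span ({x', y'} : Set T'))
        (Ideal.span ({algebraMap T T' x, algebraMap T T' y} : Set T')) hPQ) (algebraMap T' _ t) =
      algebraMap T' (Localization.AtPrime (Ideal.span ({algebraMap T T' x, algebraMap T T' y} : Set T'))) t := fun t => by
    rw [locRingEquiv_apply]; rfl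
  have hlexUp0 : IsLexMaxWeightedCentreGerm (Localization.AtPrime (Ideal.span ({algebraMap T T' x, algebraMap T T' y} : Set T')))
      (Ideal.span {algebraMap T' _ (algebraMap T T' g)}) ![algebraMap T' _ y', algebraMap T' _ x'] ![r, q] (r * ν) := by
    have h0 := LexMaxCentre.map_ringEquiv hlex'
      (locRingEquiv (RingEquiv.refl T') (Ideal.span ({x', y'} : Set T')) (Ideal.span ({algebraMap T T' x, algebraMap T T' y} : Set T')) hPQ)
    have hI : (Ideal.span {algebraMap T' (Localization.AtPrime (Ideal.span ({x', y'} : Set T'))) (algebraMap T T' g)}).map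
        ((locRingEquiv (RingEquiv.refl T') (Ideal.span ({x', y'} : Set T'))
          (Ideal.span ({algebraMap T T' x, algebraMap T T' y} : Set T')) hPQ : _ ≃+* _) : _ →+* _) =
        Ideal.span {algebraMap T' (Localization.AtPrime (Ideal.span ({algebraMap T T' x, algebraMap T T' y} : Set T'))) (algebraMap T T' g)} := by
      rw [Ideal.map_span, Set.image_singleton]
      exact congrArg (fun t => Ideal.span {t}) (he _)
    have hvec : (fun i => (locRingEquiv (RingEquiv.refl T') (Ideal.span ({x', y'} : Set T'))
          (Ideal.span ({algebraMap T T' x, algebraMap T T' y} : Set T')) hPQ)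
          ((![algebraMap T' (Localization.AtPrime (Ideal.span ({x', y'} : Set T'))) y',
             algebraMap T' (Localization.AtPrime (Ideal.span ({x', y'} : Set T'))) x'] : Fin 2 → _) i)) =
        ![algebraMap T' (Localization.AtPrime (Ideal.span ({algebraMap T T' x, algebraMap T T' y} : Set T'))) y',
          algebraMap T' (Localization.AtPrime (Ideal.span ({algebraMap T T' x, algebraMap T T' y} : Set T'))) x'] := by
      funext i; fin_cases i
      · exact he y'
      · exact he x'
    rw [hI, hvec] at h0
    exact h0
  -- the localised homomorphism `O → B`
  set O := Localization.AtPrime (Ideal.span ({x, y} : Set T)) with hO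
  set B := Localization.AtPrime (Ideal.span ({algebraMap T T' x, algebraMap T T' y} : Set T')) with hB
  have hcomap : (Ideal.span ({algebraMap T T' x, algebraMap T T' y} : Set T')).comap (algebraMap T T') = Ideal.span {x, y} :=
    comap_span_pair_map T T' x y
  letI : Algebra O B := (Localization.localRingHom _ _ (algebraMap T T') hcomap.symm).toAlgebra
  haveI : IsScalarTower T O B := IsScalarTower.of_algebraMap_eq fun s => by
    change _ = Localization.localRingHom _ _ (algebraMap T T') hcomap.symm (algebraMap T O s)
    rw [Localization.localRingHom_to_map, IsScalarTower.algebraMap_apply T T' B]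
  haveI : IsLocalHom (algebraMap O B) := Localization.isLocalHom_localRingHom _ _ (algebraMap T T') hcomap.symm
  haveI : IsRegularLocalRing O := isRegularLocalRing_localization_atPrime T _
  haveI : IsRegularLocalRing B := isRegularLocalRing_localization_atPrime T' _
  haveI := isDomain_of_isRegularLocalRing O
  haveI : Algebra.FormallySmooth T B := Algebra.FormallySmooth.comp T T' B
  haveI : Algebra.EssFiniteType T B := Algebra.EssFiniteType.comp T T' B
  haveI : Algebra.FormallySmooth O B := Algebra.FormallySmooth.localization_base (Ideal.span ({x, y} : Set T)).primeCompl
  haveI : Algebra.EssFiniteType O B := Algebra.EssFiniteType.of_comp T O B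
  haveI : Module.Flat O B := IotaOrderEssSmooth.flat_of_formallySmooth_of_essFiniteType O B
  haveI : Module.FaithfullyFlat O B := Module.FaithfullyFlat.of_flat_of_isLocalHom
  have h𝔪O : (maximalIdeal O).map (algebraMap O B) = maximalIdeal B := by
    have h1 : maximalIdeal O = (Ideal.span ({x, y} : Set T)).map (algebraMap T O) := (Localization.AtPrime.map_eq_maximalIdeal).symm
    have h2 : maximalIdeal B = (Ideal.span ({algebraMap T T' x, algebraMap T T' y} : Set T')).map (algebraMap T' B) :=
      (Localization.AtPrime.map_eq_maximalIdeal).symm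
    rw [h1, h2, Ideal.map_map, ← IsScalarTower.algebraMap_eq T O B, IsScalarTower.algebraMap_eq T T' B, ← Ideal.map_map, map_span_pair]
  have hφ : ∀ s : T, algebraMap O B (algebraMap T O s) = algebraMap T' B (algebraMap T T' s) := fun s => by
    rw [← IsScalarTower.algebraMap_apply T O B, IsScalarTower.algebraMap_apply T T' B]
  -- `g/1` in `O`: nonzero, order exactly `ν`
  haveI := isDomain_of_isRegularLocalRing T
  have hM : (Ideal.span ({x, y} : Set T)).primeCompl ≤ nonZeroDivisors T :=
    le_nonZeroDivisors_of_noZeroDivisors fun h => h (Ideal.zero_mem _)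
  have hφg0 : algebraMap T O g ≠ 0 := fun h0 => hg0 ((IsLocalization.to_map_eq_zero_iff O hM).mp h0)
  have hmemν' : g ∈ Ideal.span ({x, y} : Set T) ^ ν := by rw [← hP₀]; exact hmemν
  have hφgν : algebraMap T O g ∈ maximalIdeal O ^ ν := by
    rw [← Localization.AtPrime.map_eq_maximalIdeal, ← Ideal.map_pow]; exact Ideal.mem_map_of_mem _ hmemν'
  have hφgν1 : algebraMap T O g ∉ maximalIdeal O ^ (ν + 1) := fun h => by
    haveI := hregP
    have h2 : g ∈ Ideal.span ({x, y} : Set T) ^ (ν + 1) := by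
      rw [← EquimultipleCentre.comap_map_pow_eq (Ideal.span ({x, y} : Set T)) (Ideal.span ({x, y} : Set T)) le_rfl (ν + 1),
        Ideal.mem_comap, Ideal.map_pow, Localization.AtPrime.map_eq_maximalIdeal]
      exact h
    exact hgν1 (Ideal.pow_right_mono hPle _ h2)
  -- `(g/1)` is not a power of a regular parameter: the steep datum upstairs bounds every admissible slope
  obtain ⟨hspanB, -, -, -, -, -, hadmB, hmaxB, -⟩ := id hlexUp0
  have hyB0 : algebraMap T' B y' ∈ maximalIdeal B := hspanB ▸ Ideal.subset_span ⟨0, rfl⟩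
  have hyB1 : algebraMap T' B x' ∈ maximalIdeal B := hspanB ▸ Ideal.subset_span ⟨1, rfl⟩
  have hspanB' : Ideal.span ({algebraMap T' B y', algebraMap T' B x'} : Set B) = maximalIdeal B := by
    rw [← hspanB, Matrix.range_cons_cons_empty]
  have hny : ∀ w : O, w ∈ maximalIdeal O → w ∉ maximalIdeal O ^ 2 → ∀ n : ℕ,
      Ideal.span {algebraMap T O g} ≠ Ideal.span {w ^ n} := by
    intro w hw hw2 n heq
    obtain ⟨uu, huu⟩ := Ideal.span_singleton_eq_span_singleton.mp heq
    by_cases hn : n < ν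
    · refine ContactLevel.pow_not_mem_pow_succ_of_not_mem_sq hw2 n ?_
      rw [← huu]
      exact Ideal.mul_mem_right _ _ (Ideal.pow_le_pow_right (by omega) hφgν)
    push Not at hn
    -- push `w` to `B`
    set w' := algebraMap O B w with hw'
    have hw'𝔪 : w' ∈ maximalIdeal B := by rw [← h𝔪O]; exact Ideal.mem_map_of_mem _ hw
    have hw'2 : w' ∉ maximalIdeal B ^ 2 := fun h =>
      hw2 ((mem_pow_maximalIdeal_iff_of_map_maximalIdeal_eq h𝔪O 2 w).mpr h)
    have hgB : algebraMap T' B (algebraMap T T' g) * algebraMap O B ↑uu = w' ^ n := by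
      rw [← hφ, ← map_mul, huu, map_pow]
    -- a generating pair `Z` of `𝔪_B` with `Z 0 = w'`
    have hw'sp : w' ∈ Ideal.span ({algebraMap T' B y', algebraMap T' B x'} : Set B) := by rw [hspanB']; exact hw'𝔪
    obtain ⟨α, β, hαβ⟩ := Ideal.mem_span_pair.mp hw'sp
    have hZ : ∃ Z : Fin 2 → B, Z 0 = w' ∧ Ideal.span (Set.range Z) = maximalIdeal B := by
      by_cases hα : IsUnit α
      · refine ⟨![w', algebraMap T' B x'], rfl, ?_⟩
        rw [Matrix.range_cons_cons_empty, ← hspanB']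
        refine le_antisymm ?_ ?_
        · rw [Ideal.span_le, Set.insert_subset_iff, Set.singleton_subset_iff]
          exact ⟨by rw [hspanB']; exact hw'𝔪, Ideal.subset_span (Set.mem_insert_of_mem _ (Set.mem_singleton _))⟩
        · rw [Ideal.span_le, Set.insert_subset_iff, Set.singleton_subset_iff]
          refine ⟨?_, Ideal.subset_span (Set.mem_insert_of_mem _ (Set.mem_singleton _))⟩
          obtain ⟨αu, rfl⟩ := hα
          have : algebraMap T' B y' = ↑αu⁻¹ * w' - ↑αu⁻¹ * β * algebraMap T' B x' := by
            rw [← hαβ]; rw [mul_add, ← mul_assoc, Units.inv_mul, one_mul]; ring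
          rw [this]
          exact Ideal.sub_mem _ (Ideal.mul_mem_left _ _ (Ideal.subset_span (Set.mem_insert _ _)))
            (Ideal.mul_mem_left _ _ (Ideal.subset_span (Set.mem_insert_of_mem _ (Set.mem_singleton _))))
      · have hα𝔪 : α ∈ maximalIdeal B := (IsLocalRing.mem_maximalIdeal _).mpr (mem_nonunits_iff.mpr hα)
        have hβ : IsUnit β := by
          by_contra hβ
          have hβ𝔪 : β ∈ maximalIdeal B := (IsLocalRing.mem_maximalIdeal _).mpr (mem_nonunits_iff.mpr hβ)
          apply hw'2
          rw [← hαβ, pow_two]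
          exact Ideal.add_mem _ (Ideal.mul_mem_mul hα𝔪 hyB0) (Ideal.mul_mem_mul hβ𝔪 hyB1)
        refine ⟨![w', algebraMap T' B y'], rfl, ?_⟩
        rw [Matrix.range_cons_cons_empty, ← hspanB']
        refine le_antisymm ?_ ?_
        · rw [Ideal.span_le, Set.insert_subset_iff, Set.singleton_subset_iff]
          exact ⟨by rw [hspanB']; exact hw'𝔪, Ideal.subset_span (Set.mem_insert _ _)⟩
        · rw [Ideal.span_le, Set.insert_subset_iff, Set.singleton_subset_iff]
          refine ⟨Ideal.subset_span (Set.mem_insert_of_mem _ (Set.mem_singleton _)), ?_⟩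
          obtain ⟨βu, rfl⟩ := hβ
          have : algebraMap T' B x' = ↑βu⁻¹ * w' - ↑βu⁻¹ * α * algebraMap T' B y' := by
            rw [← hαβ]; rw [mul_add, ← mul_assoc (↑βu⁻¹ : B) (↑βu : B), Units.inv_mul, one_mul]; ring
          rw [this]
          exact Ideal.sub_mem _ (Ideal.mul_mem_left _ _ (Ideal.subset_span (Set.mem_insert _ _)))
            (Ideal.mul_mem_left _ _ (Ideal.subset_span (Set.mem_insert_of_mem _ (Set.mem_singleton _))))
    obtain ⟨Z, hZ0, hspanZ⟩ := hZ
    -- admissibility of `(Z; (r+1, 1); (r+1) n)` and lex-maximality of the steep datum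
    have hadmZ : Ideal.span {algebraMap T' B (algebraMap T T' g)} ≤ weightedMonomialIdeal Z ![r + 1, 1] ((r + 1) * n) := by
      rw [Ideal.span_singleton_le_iff_mem]
      have h1 : algebraMap T' B (algebraMap T T' g) = w' ^ n * algebraMap O B ↑uu⁻¹ := by
        rw [← hgB, mul_assoc, ← map_mul, Units.mul_inv, map_one, mul_one]
      rw [h1]
      refine Ideal.mul_mem_right _ _ (Ideal.subset_span ⟨![n, 0], ?_, ?_⟩)
      · simp [Fin.sum_univ_two]
      · rw [Fin.prod_univ_two]; simp [hZ0]
    have hcmp := hmaxB Z ![r + 1, 1] ((r + 1) * n) hspanZ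
      (fun i => by fin_cases i <;> simp) (by simp) (Nat.mul_pos (Nat.succ_pos r) (by omega)) hadmZ
    simp only [Matrix.cons_val_zero, Matrix.cons_val_one, mul_one] at hcmp
    rcases hcmp with h1 | ⟨-, h2⟩
    · have : r * ν * (r + 1) ≤ (r + 1) * n * r := by
        calc r * ν * (r + 1) = (r + 1) * ν * r := by ring
          _ ≤ (r + 1) * n * r := Nat.mul_le_mul_right _ (Nat.mul_le_mul_left _ hn)
      omega
    · have : r * ν + ν ≤ (r + 1) * n * q := by
        calc r * ν + ν = (r + 1) * ν * 1 := by ring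
          _ ≤ (r + 1) * n * q := Nat.mul_le_mul (Nat.mul_le_mul_left _ hn) hq
      omega
  -- AQS existence at `O`, and the weights agree with the tie's by ascent + uniqueness at `B`
  have hdimO2 : ringKrullDim O = 2 := by rw [hdimP]; rfl
  obtain ⟨x₁, y₁, q₁, r₁, ν₁, -, hν₁, hν₁1, -, -, hx₁y₁, hlexO⟩ :=
    AQSHeightTwo.exists_isLexMaxWeightedCentreGerm O k₀ hdimO2 (algebraMap T O g) hφg0 hny
  obtain rfl : ν = ν₁ := eq_of_mem_pow_of_not_mem_pow hφgν hφgν1 hν₁ hν₁1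
  have key := isLexMaxWeightedCentreGerm_atPrime_map' T T' x y g hdimP hlexO
  obtain ⟨hw, -, -⟩ := LexMaxCentre.eq_of_isLexMaxWeightedCentreGerm hlexUp0 key
  have hr : r = r₁ := by have := congr_fun hw 0; simpa using this
  have hq' : q = q₁ := by have := congr_fun hw 1; simpa using this
  subst hr hq'
  exact ⟨hq, hν1, hdimP, y₁, x₁, hx₁y₁, (Ideal.span_singleton_le_iff_mem _).mp hlexO.2.2.2.2.2.2.1⟩

end Datum

end Iota3

end Summit.ResolutionOfSingularities.ResolutionOfSingularities.Cruxes.HypersurfaceCentreConstruction.LocalEngine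

end
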